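import Summits.Ventures.CertifiedManyBodySolver.Observables.PairTailCeiling
import Summits.Ventures.CertifiedManyBodySolver.Observables.BoxRowBraggCeilings
import HarnessLib

/-!
# Tail ceilings at ANY wavevector: a uniform decay bound on the phase-weighted two-point function beyond range `R`
# is a ceiling on the Bragg weight at `Q` — the Néel / stripe twin of `PairTailCeiling.lean`

HONEST FRAMING: first certified bounds on pairing observables; not a superconductivity verdict; every number
certified (two lineages + referee) or labelled float.  Pure harmonic analysis; zero compute; NO definition, no named
fact, no `sorry`.  Cell hubbard-obs (D-0042 crew 1), seat hubbard-obs-p3 (CONTROLS), gen 2.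

`PairTailCeiling.lean` (p1): a ONE-SIDED tail bound `Re C(j) ≤ η` (`j ≥ 0`, `‖j‖∞ ≥ R`) on a represented lattice
function gives `braggWeight μ ![0] ≤ η` (Wiener/Cesàro).  `BraggWeightNoFloor.lean` (p3): finitely many windows give no
floor, and `BoxRowBraggCeilings.lean` / `PairBoxCeilingSharpness.lean`: finite boxes give footprint-limited ceilings.  The
input that reaches below the footprint floor at a NON-ZERO wavevector — the Néel point `(π,π)`, a stripe arm — is the
same tail bound on the PHASE-WEIGHTED function `r ↦ e^{−i r·Q} C(r)`:

* `represents_phase_of_map_sub` — if `μ` represents `C` then the translate `μ(· + Q)` (push-forward under `ξ ↦ ξ − Q`)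
  represents `r ↦ e^{−i r·Q} C(r)`; `braggWeight_map_sub_zero` — its Bragg weight at `0` is `μ`'s at `Q`.
* **`braggWeight_le_of_phase_tail_bound`** (any `d ≥ 1`, any `Q ∈ ℝᵈ`): if `Re (e^{−i j·Q} C(j)) ≤ η` for every `j ≥ 0`
  with `‖j‖∞ ≥ R`, then `braggWeight μ ![Q] ≤ η`.
* **`braggWeight_pi_le_of_stag_tail_bound`** (`Q = (π,…,π)`): if the STAGGERED tail obeys `(−1)^{Σᵢ jᵢ} Re C(j) ≤ η`
  beyond range `R`, the antiferromagnetic Bragg weight is `≤ η`; state form `neel_braggWeight_le_of_stag_tail_bound` for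
  the `D₄`-orbit-mean spin correlation of any state on `ℤ²`: a future clustering/decay theorem for the doped ground
  states, uniform in `r`, converts directly into a Néel-weight ceiling below the box floor (TARGET §10 (10b)).
HONEST: this file supplies no tail bound; it records what one would buy.  A ceiling says nothing about the presence
of order.

References: Katznelson, *An Introduction to Harmonic Analysis* (2004) I.7; Scalapino, Phys. Rep. 250 (1995) 329, §2.
-/

noncomputable section

open MeasureTheory Complex Filter Topology
open scoped Real BigOperators

namespace Summit.Ventures.CertifiedManyBodySolver.Observables

section General

variable {d : ℕ} {C : (Fin d → ℤ) → ℂ} (μ : Measure (EuclideanSpace ℝ (Fin d))) [IsFiniteMeasure μ]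

/-- Translation by `−Q` is measurable. -/
private theorem measurable_sub_toLp (Q : Fin d → ℝ) :
    Measurable (fun ξ : EuclideanSpace ℝ (Fin d) => ξ - WithLp.toLp 2 Q) :=
  measurable_id.sub_const _

omit [IsFiniteMeasure μ] in
/-- **The translate represents the phase-weighted function.**  If `∫ e^{i r·ξ} dμ = C r` then the push-forward of `μ`
under `ξ ↦ ξ − Q` satisfies `∫ e^{i r·ξ} d(μ ∘ (· + Q)) = e^{−i r·Q} C(r)`. [cite: Katznelson2004, I.7] -/
theorem represents_phase_of_map_sub
    (hμ : ∀ r : Fin d → ℤ, ∫ ξ, exp ((∑ i, (r i : ℝ) * ξ i : ℝ) * I) ∂μ = C r) (Q : Fin d → ℝ) (r : Fin d → ℤ) :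
    ∫ ξ, exp ((∑ i, (r i : ℝ) * ξ i : ℝ) * I) ∂(μ.map (fun ξ => ξ - WithLp.toLp 2 Q)) =
      exp (-((((∑ i, (r i : ℝ) * Q i : ℝ)) : ℂ) * I)) * C r := by
  rw [integral_map (measurable_sub_toLp Q).aemeasurable]
  · have h : (fun ξ : EuclideanSpace ℝ (Fin d) => exp ((∑ i, (r i : ℝ) * (ξ - WithLp.toLp 2 Q) i : ℝ) * I))
        = fun ξ => exp ((((∑ i, (r i : ℝ) * (ξ i - Q i) : ℝ)) : ℂ) * I) := by
      funext ξ
      simp only [WithLp.ofLp_sub, Pi.sub_apply]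
    rw [h]
    exact integral_exp_shift μ hμ Q r
  · exact (Complex.continuous_exp.comp ((Complex.continuous_ofReal.comp (by fun_prop)).mul
      continuous_const)).aestronglyMeasurable

omit [IsFiniteMeasure μ] in
/-- **The translate moves the Bragg peak to the origin**: `braggWeight (μ ∘ (· + Q)) ![0] = braggWeight μ ![Q]`.
[cite: Katznelson2004, I.7] -/
theorem braggWeight_map_sub_zero (Q : Fin d → ℝ) :
    braggWeight (μ.map (fun ξ => ξ - WithLp.toLp 2 Q)) ![(0 : Fin d → ℝ)] = braggWeight μ ![Q] := by
  rw [braggWeight_single, braggWeight_single, Measure.real, Measure.real,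
    Measure.map_apply (measurable_sub_toLp Q) (measurableSet_braggSet _)]
  congr 2
  ext ξ
  simp only [Set.mem_preimage, braggSet, Set.mem_setOf_eq, WithLp.ofLp_sub, Pi.sub_apply,
    Pi.zero_apply, zero_add]
  exact ⟨fun ⟨m, hm⟩ => ⟨m, fun i => by linarith [hm i]⟩, fun ⟨m, hm⟩ => ⟨m, fun i => by linarith [hm i]⟩⟩

/-- **Tail ceiling at any wavevector.**  For `d ≥ 1`, a finite `μ` representing `C`, `Q ∈ ℝᵈ`: if the phase-weighted
two-point function obeys `Re (e^{−i j·Q} C(j)) ≤ η` for every `j` in the positive orthant with some coordinate `≥ R`,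
then `braggWeight μ ![Q] ≤ η`. (p1's `braggWeight_zero_le_of_tail_bound` applied to the translate.)
[cite: Katznelson2004, I.7] -/
theorem braggWeight_le_of_phase_tail_bound (hd : 1 ≤ d)
    (hμ : ∀ r : Fin d → ℤ, ∫ ξ, exp ((∑ i, (r i : ℝ) * ξ i : ℝ) * I) ∂μ = C r)
    (Q : Fin d → ℝ) (R : ℕ) (η : ℝ)
    (htail : ∀ j : Fin d → ℤ, (∀ i, 0 ≤ j i) → (∃ i, (R : ℤ) ≤ j i) →
      (exp (-((((∑ i, (j i : ℝ) * Q i : ℝ)) : ℂ) * I)) * C j).re ≤ η) :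
    braggWeight μ ![Q] ≤ η := by
  rw [← braggWeight_map_sub_zero μ Q]
  haveI : IsFiniteMeasure (μ.map (fun ξ : EuclideanSpace ℝ (Fin d) => ξ - WithLp.toLp 2 Q)) := inferInstance
  exact braggWeight_zero_le_of_tail_bound (μ.map (fun ξ => ξ - WithLp.toLp 2 Q)) hd
    (C := fun r => exp (-((((∑ i, (r i : ℝ) * Q i : ℝ)) : ℂ) * I)) * C r)
    (fun r => represents_phase_of_map_sub μ hμ Q r) R η htail

/-- **Staggered tail ceiling** (`Q = (π,…,π)`): if `(−1)^{Σᵢ jᵢ} · Re C(j) ≤ η` for every `j ≥ 0` with `‖j‖∞ ≥ R`, then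
the antiferromagnetic Bragg weight satisfies `braggWeight μ ![(π,…,π)] ≤ η`. [cite: Katznelson2004, I.7] -/
theorem braggWeight_pi_le_of_stag_tail_bound (hd : 1 ≤ d)
    (hμ : ∀ r : Fin d → ℤ, ∫ ξ, exp ((∑ i, (r i : ℝ) * ξ i : ℝ) * I) ∂μ = C r)
    (R : ℕ) (η : ℝ)
    (htail : ∀ j : Fin d → ℤ, (∀ i, 0 ≤ j i) → (∃ i, (R : ℤ) ≤ j i) →
      (-1 : ℝ) ^ (∑ i, j i) * (C j).re ≤ η) :
    braggWeight μ ![(fun _ : Fin d => π)] ≤ η :=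
  braggWeight_le_of_phase_tail_bound μ hd hμ (fun _ => π) R η fun j hj hR => by
    rw [re_exp_neg_pi_mul_eq]; exact htail j hj hR

end General

/-! ### State form at the Néel point of `ℤ²` -/

section Neel

open Literature.MathematicalPhysics.QuantumLattice Literature.Probability.LatticeModels
open Summit.Ventures.CertifiedManyBodySolver.Certificates

/-- **A staggered decay bound on the spin correlation is a Néel-weight ceiling.**  For any state `ω` on `ℤ²` and any
finite measure `μ` representing its `D₄`-orbit-mean spin correlation `spinOrbitCorr ω`: if
`(−1)^{j₁+j₂} · Re spinOrbitCorr ω j ≤ η` for every `j ≥ 0` with `‖j‖∞ ≥ R` (a clustering / decay input UNIFORM in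
`j`), then `μ((π,π) + 2πℤ²) ≤ η` — below the footprint floor of every box row.  A CEILING; it says nothing about the
presence of order, and this file supplies no decay bound. [cite: Scalapino1995, §2] -/
theorem neel_braggWeight_le_of_stag_tail_bound (ω : InfVolFermionState 2)
    (μ : Measure (EuclideanSpace ℝ (Fin 2))) [IsFiniteMeasure μ]
    (hμ : ∀ r : Site 2, ∫ ξ, exp ((∑ i, (r i : ℝ) * ξ i : ℝ) * I) ∂μ = spinOrbitCorr ω r)
    (R : ℕ) (η : ℝ)
    (htail : ∀ j : Site 2, (∀ i, 0 ≤ j i) → (∃ i, (R : ℤ) ≤ j i) →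
      (-1 : ℝ) ^ (∑ i, j i) * (spinOrbitCorr ω j).re ≤ η) :
    braggWeight μ ![![π, π]] ≤ η := by
  have hQ : (![π, π] : Fin 2 → ℝ) = fun _ => π := by funext i; fin_cases i <;> rfl
  rw [hQ]
  exact braggWeight_pi_le_of_stag_tail_bound μ (by norm_num) hμ R η htail

end Neel

end Summit.Ventures.CertifiedManyBodySolver.Observables

end
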